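import Summits.QuantumFields.YangMills.Theorems.BalabanLadderIRTwistedSlabSliceChartSmooth
import Literature.MathematicalPhysics.QuantumFieldTheory.Balaban1983to89.LogChartProduct
import HarnessLib

/-!
# The slice chart in B89's currency, I: the `Ad(Lᴴ)`-twisted frame `(Fin 4 → suFields) ≃L 𝔤^E` and the MODEL CHART on a real inner-product
# model space (its `C¹`/injectivity/half-window/link data) — input of the `hchart` identity of M1b

HELPER toward stub **T1** `TwistedSlabAnchor` (LINE `twisted-slab-continuity`, crux `IRcof` stmt-QuantumFields-26930, census row 43;
LEAD prover ym-ir-line-tsc-p1 g3; `--supports` the crux, `--as helper`).  Sequel of K15a–c (`…LogChart`, `…SliceChart`, `…SliceChartSmooth`);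
consumes lit-4 L11 `LogChartProduct.piLogChart` and B89's `specialUnitaryLogChart` BY NAME.
NORM SCOPES: this file is `Matrix.Norms.L2Operator` (B89 ∕ lit-4 currency); the K15 files are `Matrix.Norms.Frobenius`.  The bridge is sound because
everything imported from K15 is TOPOLOGICAL (`HasStrictFDerivAt`, `fderiv`, `OpenPartialHomeomorph`, `∀ᶠ … in 𝓝 0`, `exp`) and both scoped matrix
norms carry the product topology definitionally.
* §1 `adFrame hL : (Fin 4 → suFields) ≃L[ℝ] 𝔤^E` — the `Ad(Lᴴ)`-twisted frame `v ↦ (e ↦ L(e)ᴴ v_{e.2}(e.1) L(e))` (turns LEFT fluctuations `exp(Y)·L` into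
  B89's RIGHT chart `L·exp(X)`, `X = Lᴴ Y L`); `coe_adFrame_apply`.
* §2 (any `L ∈ SU(N)^E`, any real inner-product MODEL space `V`, frame `T : V ≃L[ℝ] suFields × realCoulombSlice L`, identification
  `D : suFields × realCoulombSlice L ≃L (Fin 4 → suFields)`) `modelPsi D T : V → V` (`= T⁻¹ ∘ D⁻¹ ∘ Ψ̂ ∘ T`), `modelFrame hL D T : V ≃L[ℝ] 𝔤^E`,
  `modelFrame_modelPsi`, `modelPsi_zero`, `fderiv_modelPsi`, `fderiv_modelPsi_zero` (`= id` when `D = DΨ̂(0)`), `hasFDerivAt_modelPsi`, `injOn_modelPsi`,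
  ★ `exists_modelPsi_chartData` (given an open `S ∋ 0` with `Ψ̂` injective on `S`: an open `W ∋ 0` with `InjOn`, `HasFDerivWithinAt`, continuous `fderiv`,
  continuity, the half-window condition through `modelFrame`, and the link identity `L(e)·exp(X_e) = orbitFluct L (T z) e`).
NOT here (honest scope): the Haar-measure identity itself (next file), the product splitting of the Lebesgue measure, FP localisation, anything uniform
in `β` (M3), the cluster expansion (M4); T1-box 0∕1, T1 proper 0∕1.

HONEST FRAMING: finite-dimensional calculus ∕ plumbing on one box; nothing here bears on `IRcof`, `IR`, or the Yang–Mills mass gap (Clay: NOT proved);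
R4 = `BalabanLadder.UV` only.  References: S. Helgason, *Groups and Geometric Analysis* Ch. I §1 Thm 1.14 (13) p. 96; K. W. Breitung, *Asymptotic
Approximations for Probability Integrals* (1994) §2.3; M. García Pérez, A. González-Arroyo, M. Okawa, JHEP 10 (2017) 150 §2.3, §2.5.
-/

set_option autoImplicit false

noncomputable section

open scoped Matrix Matrix.Norms.L2Operator Topology ENNReal
open MeasureTheory Filter NormedSpace Set
open Literature.MathematicalPhysics.QuantumFieldTheory Literature.MathematicalPhysics.QuantumLattice
open Literature.Analysis.OperatorTheory
open Literature.MathematicalPhysics.QuantumFieldTheory.Balaban1983to89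
open Literature.MathematicalPhysics.QuantumFieldTheory.Balaban1983to89.HaarExponentialChart
open Literature.MathematicalPhysics.QuantumFieldTheory.Balaban1983to89.LogChartProduct
open Literature.MathematicalPhysics.QuantumFieldTheory.Balaban1983to89.B13HaarSigmaJacobian (jac)

namespace Summit.QuantumFields.YangMills.Cruxes.IRcof.TwistedSlab

variable {N : ℕ} [NeZero N] {n₀ n₁ n₂ n₃ : ℕ}

/-! ## §1 The `Ad(Lᴴ)`-twisted frame `(Fin 4 → suFields) ≃L 𝔤^E` -/

section Frame

variable (L : FinTorusSite n₀ n₁ n₂ n₃ × Fin 4 → Matrix (Fin N) (Fin N) ℂ)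

/-- `Ad(Lᴴ)` of an `𝔰𝔲`-field, read on links: `v ↦ (e ↦ L(e)ᴴ · v_{e.2}(e.1) · L(e))`. [cite: Helgason2000, Ch. I §1 Thm 1.14 p. 96] -/
def adFrameFun (v : Fin 4 → suFields N n₀ n₁ n₂ n₃) : FinTorusSite n₀ n₁ n₂ n₃ × Fin 4 → Matrix (Fin N) (Fin N) ℂ :=
  fun e => (L e)ᴴ * ((v e.2 : suFields N n₀ n₁ n₂ n₃) : FinTorusSite n₀ n₁ n₂ n₃ → Matrix (Fin N) (Fin N) ℂ) e.1 * L e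

/-- `Ad(L)` of an element of `𝔤^E`, read as an `𝔰𝔲`-field: `X ↦ (μ ↦ x ↦ L(x,μ) · X(x,μ) · L(x,μ)ᴴ)` (ambient version). [folklore] -/
def adFrameInvFun (X : FinTorusSite n₀ n₁ n₂ n₃ × Fin 4 → Matrix (Fin N) (Fin N) ℂ) :
    Fin 4 → FinTorusSite n₀ n₁ n₂ n₃ → Matrix (Fin N) (Fin N) ℂ :=
  fun μ x => L (x, μ) * X (x, μ) * (L (x, μ))ᴴ

variable {L}

omit [NeZero N] in
/-- Conjugating a traceless skew-Hermitian matrix by a unitary keeps it traceless skew-Hermitian. [folklore] -/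
private theorem skew_traceless_conj {U Y : Matrix (Fin N) (Fin N) ℂ} (hU : U * Uᴴ = 1) (hY : Yᴴ = -Y) (htr : Y.trace = 0) :
    (Uᴴ * Y * U)ᴴ = -(Uᴴ * Y * U) ∧ (Uᴴ * Y * U).trace = 0 := by
  refine ⟨?_, ?_⟩
  · rw [Matrix.conjTranspose_mul, Matrix.conjTranspose_mul, Matrix.conjTranspose_conjTranspose, hY, Matrix.neg_mul, Matrix.mul_neg,
      Matrix.mul_assoc]
  · rw [Matrix.trace_mul_cycle, hU, Matrix.one_mul, htr]

/-- The twisted frame lands in `𝔤^E = 𝔰𝔲(N)^E` (unitary `L`). [cite: Helgason2000, Ch. I §1 Thm 1.14 p. 96] -/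
theorem adFrameFun_mem (hL : ∀ e, L e ∈ Matrix.unitaryGroup (Fin N) ℂ) (v : Fin 4 → suFields N n₀ n₁ n₂ n₃) :
    adFrameFun L v ∈ (piLogChart (specialUnitaryLogChart (Fin N)) (FinTorusSite n₀ n₁ n₂ n₃ × Fin 4)).lie := by
  refine (mem_piLogChart_lie _ _).2 fun e => mem_specialUnitaryLogChart_lie.2 ?_
  have hLL : L e * (L e)ᴴ = 1 := by
    have h := Matrix.mem_unitaryGroup_iff.1 (hL e); simpa only [Matrix.star_eq_conjTranspose] using h
  have h := skew_traceless_conj hLL ((v e.2).2 e.1).1 ((v e.2).2 e.1).2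
  rw [Matrix.star_eq_conjTranspose]
  exact h

/-- The inverse lands in `𝔰𝔲`-fields (unitary `L`). [folklore] -/
theorem adFrameInvFun_mem (hL : ∀ e, L e ∈ Matrix.unitaryGroup (Fin N) ℂ)
    (X : (piLogChart (specialUnitaryLogChart (Fin N)) (FinTorusSite n₀ n₁ n₂ n₃ × Fin 4)).lie) (μ : Fin 4) :
    adFrameInvFun L (X : FinTorusSite n₀ n₁ n₂ n₃ × Fin 4 → Matrix (Fin N) (Fin N) ℂ) μ ∈ suFields N n₀ n₁ n₂ n₃ := by
  rw [mem_suFields]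
  intro x
  have hX := mem_specialUnitaryLogChart_lie.1 ((mem_piLogChart_lie _ _).1 X.2 (x, μ))
  rw [Matrix.star_eq_conjTranspose] at hX
  have hLL : (L (x, μ))ᴴ * ((L (x, μ))ᴴ)ᴴ = 1 := by
    rw [Matrix.conjTranspose_conjTranspose]
    have h := Matrix.mem_unitaryGroup_iff'.1 (hL (x, μ)); simpa only [Matrix.star_eq_conjTranspose] using h
  have h := skew_traceless_conj hLL hX.1 hX.2
  rw [Matrix.conjTranspose_conjTranspose] at h
  exact h

/-- The twisted frame as a linear equivalence. [cite: Helgason2000, Ch. I §1 Thm 1.14 p. 96] -/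
def adFrameLinearEquiv (hL : ∀ e, L e ∈ Matrix.unitaryGroup (Fin N) ℂ) :
    (Fin 4 → suFields N n₀ n₁ n₂ n₃) ≃ₗ[ℝ] (piLogChart (specialUnitaryLogChart (Fin N)) (FinTorusSite n₀ n₁ n₂ n₃ × Fin 4)).lie where
  toFun v := ⟨adFrameFun L v, adFrameFun_mem hL v⟩
  map_add' v w := by
    apply Subtype.ext; funext e
    show adFrameFun L (v + w) e = adFrameFun L v e + adFrameFun L w e
    simp only [adFrameFun, Pi.add_apply, Submodule.coe_add, Matrix.mul_add, Matrix.add_mul]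
  map_smul' c v := by
    apply Subtype.ext; funext e
    show adFrameFun L (c • v) e = c • adFrameFun L v e
    simp only [adFrameFun, Pi.smul_apply, Submodule.coe_smul, Matrix.mul_smul, Matrix.smul_mul]
  invFun X := fun μ => ⟨adFrameInvFun L (X : FinTorusSite n₀ n₁ n₂ n₃ × Fin 4 → Matrix (Fin N) (Fin N) ℂ) μ, adFrameInvFun_mem hL X μ⟩
  left_inv v := by
    funext μ; apply Subtype.ext; funext x
    have h1 : L (x, μ) * (L (x, μ))ᴴ = 1 := by
      have h := Matrix.mem_unitaryGroup_iff.1 (hL (x, μ)); simpa only [Matrix.star_eq_conjTranspose] using h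
    show L (x, μ) * ((L (x, μ))ᴴ * ((v μ : suFields N n₀ n₁ n₂ n₃) : FinTorusSite n₀ n₁ n₂ n₃ → Matrix (Fin N) (Fin N) ℂ) x * L (x, μ)) *
      (L (x, μ))ᴴ = ((v μ : suFields N n₀ n₁ n₂ n₃) : FinTorusSite n₀ n₁ n₂ n₃ → Matrix (Fin N) (Fin N) ℂ) x
    rw [← Matrix.mul_assoc, ← Matrix.mul_assoc, h1, Matrix.one_mul, Matrix.mul_assoc, h1, Matrix.mul_one]
  right_inv X := by
    apply Subtype.ext; funext e
    have h1 : (L e)ᴴ * L e = 1 := by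
      have h := Matrix.mem_unitaryGroup_iff'.1 (hL e); simpa only [Matrix.star_eq_conjTranspose] using h
    show (L e)ᴴ * (L (e.1, e.2) * (X : FinTorusSite n₀ n₁ n₂ n₃ × Fin 4 → Matrix (Fin N) (Fin N) ℂ) (e.1, e.2) * (L (e.1, e.2))ᴴ) * L e =
      (X : FinTorusSite n₀ n₁ n₂ n₃ × Fin 4 → Matrix (Fin N) (Fin N) ℂ) e
    rw [Prod.mk.eta, ← Matrix.mul_assoc, ← Matrix.mul_assoc, h1, Matrix.one_mul, Matrix.mul_assoc, h1, Matrix.mul_one]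

/-- ★ **The `Ad(Lᴴ)`-twisted frame** `(Fin 4 → suFields) ≃L[ℝ] 𝔤^E` (continuous: finite dimension). [cite: Helgason2000, Ch. I §1 Thm 1.14 p. 96] -/
def adFrame (hL : ∀ e, L e ∈ Matrix.unitaryGroup (Fin N) ℂ) :
    (Fin 4 → suFields N n₀ n₁ n₂ n₃) ≃L[ℝ] (piLogChart (specialUnitaryLogChart (Fin N)) (FinTorusSite n₀ n₁ n₂ n₃ × Fin 4)).lie :=
  (adFrameLinearEquiv hL).toContinuousLinearEquiv

/-- Components of the twisted frame. [folklore] -/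
theorem coe_adFrame_apply (hL : ∀ e, L e ∈ Matrix.unitaryGroup (Fin N) ℂ) (v : Fin 4 → suFields N n₀ n₁ n₂ n₃)
    (e : FinTorusSite n₀ n₁ n₂ n₃ × Fin 4) :
    ((adFrame hL v : (piLogChart (specialUnitaryLogChart (Fin N)) (FinTorusSite n₀ n₁ n₂ n₃ × Fin 4)).lie) :
        FinTorusSite n₀ n₁ n₂ n₃ × Fin 4 → Matrix (Fin N) (Fin N) ℂ) e =
      (L e)ᴴ * ((v e.2 : suFields N n₀ n₁ n₂ n₃) : FinTorusSite n₀ n₁ n₂ n₃ → Matrix (Fin N) (Fin N) ℂ) e.1 * L e := rfl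

end Frame

omit [NeZero N] in
/-- `U · exp(Uᴴ Z U) = exp(Z) · U` for unitary `U` (`exp` commutes with conjugation). [folklore] -/
private theorem mul_exp_conj_of_unitary {U Z : Matrix (Fin N) (Fin N) ℂ} (hU : U * Uᴴ = 1) : U * exp (Uᴴ * Z * U) = exp Z * U := by
  letI : NormedAlgebra ℚ ℂ := NormedAlgebra.restrictScalars ℚ ℝ ℂ
  have hunit : IsUnit Uᴴ := (Matrix.isUnit_iff_isUnit_det _).2 (Matrix.isUnit_det_of_left_inverse hU)
  have hinv : (Uᴴ)⁻¹ = U := Matrix.inv_eq_left_inv hU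
  have h := Matrix.exp_conj Uᴴ Z hunit
  rw [hinv] at h
  rw [h, ← Matrix.mul_assoc, ← Matrix.mul_assoc, hU, Matrix.one_mul]

/-! ## §2 The model chart on a model space and its chart data (any special-unitary background with IFT data) -/

section Model

variable {L : FinTorusSite n₀ n₁ n₂ n₃ × Fin 4 → Matrix (Fin N) (Fin N) ℂ}
variable {V : Type*} [NormedAddCommGroup V] [InnerProductSpace ℝ V]

/-- **The model chart** `modelPsi D T = T⁻¹ ∘ D⁻¹ ∘ Ψ̂ ∘ T : V → V` for a frame `T` of the `𝔰𝔲` data by a model space `V` and a linear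
identification `D` of the `𝔰𝔲` data with the `𝔰𝔲` fluctuations (at the twist eater: `D = DΨ̂(0)`, so that `D(modelPsi)(0) = id`).
[cite: Breitung1994, §2.3 Definitions 4–5 pp. 14–15] -/
def modelPsi (D : (suFields N n₀ n₁ n₂ n₃ × realCoulombSlice L) ≃L[ℝ] (Fin 4 → suFields N n₀ n₁ n₂ n₃))
    (T : V ≃L[ℝ] (suFields N n₀ n₁ n₂ n₃ × realCoulombSlice L)) : V → V :=
  fun z => T.symm (D.symm (slicePsiSu L (T z)))

/-- **The model frame** `modelFrame = adFrame ∘ D ∘ T : V ≃L[ℝ] 𝔤^E` (unitary background). [cite: Helgason2000, Ch. I §1 Thm 1.14 p. 96] -/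
def modelFrame (hL : ∀ e, L e ∈ Matrix.unitaryGroup (Fin N) ℂ)
    (D : (suFields N n₀ n₁ n₂ n₃ × realCoulombSlice L) ≃L[ℝ] (Fin 4 → suFields N n₀ n₁ n₂ n₃))
    (T : V ≃L[ℝ] (suFields N n₀ n₁ n₂ n₃ × realCoulombSlice L)) :
    V ≃L[ℝ] (piLogChart (specialUnitaryLogChart (Fin N)) (FinTorusSite n₀ n₁ n₂ n₃ × Fin 4)).lie :=
  T.trans (D.trans (adFrame hL))

variable (D : (suFields N n₀ n₁ n₂ n₃ × realCoulombSlice L) ≃L[ℝ] (Fin 4 → suFields N n₀ n₁ n₂ n₃))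
  (T : V ≃L[ℝ] (suFields N n₀ n₁ n₂ n₃ × realCoulombSlice L))

/-- `modelFrame (modelPsi z) = adFrame (Ψ̂ (T z))`. [folklore] -/
theorem modelFrame_modelPsi (hL : ∀ e, L e ∈ Matrix.unitaryGroup (Fin N) ℂ) (z : V) :
    modelFrame hL D T (modelPsi D T z) = adFrame hL (slicePsiSu L (T z)) := by
  simp only [modelFrame, modelPsi, ContinuousLinearEquiv.trans_apply, ContinuousLinearEquiv.apply_symm_apply]

omit [NeZero N] in
/-- `modelPsi 0 = 0` (unitary background). [folklore] -/
theorem modelPsi_zero (hL : ∀ e, L e ∈ Matrix.unitaryGroup (Fin N) ℂ) : modelPsi D T 0 = 0 := by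
  simp only [modelPsi, map_zero, slicePsiSu_zero hL, map_zero]

omit [NeZero N] in
/-- The derivative of the model chart, unconditionally: `fderiv (modelPsi D T) z = T⁻¹ ∘ D⁻¹ ∘ fderiv Ψ̂ (T z) ∘ T`. [folklore] -/
theorem fderiv_modelPsi (z : V) :
    fderiv ℝ (modelPsi D T) z = (T.symm.arrowCongr (D.symm.trans T.symm)) (fderiv ℝ (slicePsiSu L) (T z)) := by
  have h1 : modelPsi D T = ⇑(D.symm.trans T.symm) ∘ (slicePsiSu L ∘ ⇑T) := rfl
  rw [h1, ContinuousLinearEquiv.comp_fderiv, ContinuousLinearEquiv.comp_right_fderiv]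
  refine ContinuousLinearMap.ext fun x => ?_
  rw [ContinuousLinearEquiv.arrowCongr_apply, ContinuousLinearMap.comp_apply, ContinuousLinearMap.comp_apply, ContinuousLinearEquiv.coe_coe,
    ContinuousLinearEquiv.coe_coe, ContinuousLinearEquiv.symm_symm]

omit [NeZero N] in
/-- If `D = DΨ̂(0)` then the derivative of the model chart at `0` is the identity. [folklore] -/
theorem fderiv_modelPsi_zero (hD : fderiv ℝ (slicePsiSu L) 0 = (D : _ →L[ℝ] (Fin 4 → suFields N n₀ n₁ n₂ n₃))) :
    fderiv ℝ (modelPsi D T) 0 = ContinuousLinearMap.id ℝ V := by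
  rw [fderiv_modelPsi, map_zero, hD]
  refine ContinuousLinearMap.ext fun x => ?_
  rw [ContinuousLinearEquiv.arrowCongr_apply, ContinuousLinearEquiv.trans_apply, ContinuousLinearEquiv.coe_coe, ContinuousLinearEquiv.symm_symm,
    ContinuousLinearEquiv.symm_apply_apply, ContinuousLinearEquiv.symm_apply_apply, ContinuousLinearMap.id_apply]

omit [NeZero N] in
/-- Differentiability of the model chart at the points of `T⁻¹U`, `U` the `C¹` neighbourhood of K15c. [folklore] -/
theorem hasFDerivAt_modelPsi {U : Set (suFields N n₀ n₁ n₂ n₃ × realCoulombSlice L)}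
    (hUd : ∀ q ∈ U, HasFDerivAt (slicePsiSu L) (fderiv ℝ (slicePsiSu L) q) q) {z : V} (hz : T z ∈ U) :
    HasFDerivAt (modelPsi D T) (fderiv ℝ (modelPsi D T) z) z := by
  have h2 := ((D.symm.trans T.symm).hasFDerivAt).comp z ((hUd (T z) hz).comp z T.hasFDerivAt)
  exact (h2 : HasFDerivAt (modelPsi D T) _ z).differentiableAt.hasFDerivAt

omit [NeZero N] in
/-- Injectivity of the model chart where `Ψ̂` is injective. [folklore] -/
theorem injOn_modelPsi {S : Set (suFields N n₀ n₁ n₂ n₃ × realCoulombSlice L)} (hSinj : InjOn (slicePsiSu L) S) :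
    InjOn (modelPsi D T) (T ⁻¹' S) := by
  intro z₁ hz₁ z₂ hz₂ heq
  have h1 : slicePsiSu L (T z₁) = slicePsiSu L (T z₂) := by
    have h := congrArg (fun v => D (T v)) heq
    simpa only [modelPsi, ContinuousLinearEquiv.apply_symm_apply] using h
  exact T.injective (hSinj hz₁ hz₂ h1)

/-- ★ **CHART DATA OF THE MODEL CHART** (`L ∈ SU(N)^E`; `S ∋ 0` an open set on which `Ψ̂` is injective — at the twist eater the IFT source):
an open `W ∋ 0` on which `modelPsi D T` is injective, differentiable within `W` with derivative `fderiv (modelPsi D T)`, with `modelPsi` and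
`fderiv (modelPsi D T)` continuous on `W`, mapping `W` into the half-window of the product chart through the model frame, and on which the link
identity `L(x,μ) · exp(X_{(x,μ)}) = orbitFluct L (T z) (μ, x)` holds for `X = modelFrame (modelPsi z)`.
[cite: Helgason2000, Ch. I §1 Thm 1.14 (13) p. 96] [cite: Breitung1994, §2.3 Definitions 4–5 pp. 14–15] -/
theorem exists_modelPsi_chartData (hL : ∀ e, L e ∈ Matrix.unitaryGroup (Fin N) ℂ) (hLsu : ∀ e, L e ∈ Matrix.specialUnitaryGroup (Fin N) ℂ)
    {S : Set (suFields N n₀ n₁ n₂ n₃ × realCoulombSlice L)} (hSo : IsOpen S)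
    (hS0 : (0 : suFields N n₀ n₁ n₂ n₃ × realCoulombSlice L) ∈ S) (hSinj : InjOn (slicePsiSu L) S) :
    ∃ W : Set V, IsOpen W ∧ (0 : V) ∈ W ∧ InjOn (modelPsi D T) W ∧
      (∀ z ∈ W, HasFDerivWithinAt (modelPsi D T) (fderiv ℝ (modelPsi D T) z) W z) ∧
      ContinuousOn (fderiv ℝ (modelPsi D T)) W ∧ ContinuousOn (modelPsi D T) W ∧
      modelPsi D T '' W ⊆ (modelFrame hL D T) ⁻¹'
        Metric.ball 0 (IsChartRep.chartRadius (piLogChart (specialUnitaryLogChart (Fin N)) (FinTorusSite n₀ n₁ n₂ n₃ × Fin 4)) / 2) ∧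
      ∀ z ∈ W, ∀ (x : FinTorusSite n₀ n₁ n₂ n₃) (μ : Fin 4),
        L (x, μ) * exp (((modelFrame hL D T (modelPsi D T z) :
          (piLogChart (specialUnitaryLogChart (Fin N)) (FinTorusSite n₀ n₁ n₂ n₃ × Fin 4)).lie) :
            FinTorusSite n₀ n₁ n₂ n₃ × Fin 4 → Matrix (Fin N) (Fin N) ℂ) (x, μ)) =
          orbitFluct L (suDataIncl L (T z)) μ x := by
  -- (a) local `C¹` data of `Ψ̂` (K15c) and the exponential link identity near `0` (K15b)
  obtain ⟨U, hUo, hU0, hUd, hUc⟩ := exists_isOpen_slicePsiSu_hasFDerivAt (n₀ := n₀) (n₁ := n₁) (n₂ := n₂) (n₃ := n₃) hLsu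
  obtain ⟨O, hOexp, hOo, hO0⟩ := eventually_nhds_iff.1 (eventually_exp_slicePsiSu_mul (n₀ := n₀) (n₁ := n₁) (n₂ := n₂) (n₃ := n₃) hLsu)
  -- (b) the open set `W₀ = T⁻¹(U ∩ S ∩ O)` and continuity of the model chart there
  have hW₀o : IsOpen (T ⁻¹' (U ∩ S ∩ O)) := ((hUo.inter hSo).inter hOo).preimage T.continuous
  have hW₀0 : (0 : V) ∈ T ⁻¹' (U ∩ S ∩ O) := by
    show T 0 ∈ U ∩ S ∩ O
    rw [map_zero]; exact ⟨⟨hU0, hS0⟩, hO0⟩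
  have hderiv : ∀ z ∈ T ⁻¹' (U ∩ S ∩ O), HasFDerivAt (modelPsi D T) (fderiv ℝ (modelPsi D T) z) z :=
    fun z hz => hasFDerivAt_modelPsi D T hUd hz.1.1
  have hcontΨ : ContinuousOn (modelPsi D T) (T ⁻¹' (U ∩ S ∩ O)) := fun z hz => (hderiv z hz).continuousAt.continuousWithinAt
  -- (c) shrink so that the frame image lies in the half-window
  have hBo : IsOpen ((modelFrame hL D T) ⁻¹'
      Metric.ball 0 (IsChartRep.chartRadius (piLogChart (specialUnitaryLogChart (Fin N)) (FinTorusSite n₀ n₁ n₂ n₃ × Fin 4)) / 2)) :=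
    Metric.isOpen_ball.preimage (modelFrame hL D T).continuous
  refine ⟨T ⁻¹' (U ∩ S ∩ O) ∩ modelPsi D T ⁻¹' ((modelFrame hL D T) ⁻¹'
      Metric.ball 0 (IsChartRep.chartRadius (piLogChart (specialUnitaryLogChart (Fin N)) (FinTorusSite n₀ n₁ n₂ n₃ × Fin 4)) / 2)),
    hcontΨ.isOpen_inter_preimage hW₀o hBo, ?_, ?_, ?_, ?_, hcontΨ.mono Set.inter_subset_left, ?_, ?_⟩
  · -- `0 ∈ W`
    refine ⟨hW₀0, ?_⟩
    show modelFrame hL D T (modelPsi D T 0) ∈ Metric.ball 0 _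
    rw [modelPsi_zero D T hL, map_zero]
    exact Metric.mem_ball_self (half_pos (IsChartRep.chartRadius_pos
      (C := piLogChart (specialUnitaryLogChart (Fin N)) (FinTorusSite n₀ n₁ n₂ n₃ × Fin 4))))
  · -- injectivity
    exact (injOn_modelPsi D T hSinj).mono fun z hz => hz.1.1.2
  · -- derivative within `W`
    intro z hz
    exact (hderiv z hz.1).hasFDerivWithinAt
  · -- continuity of the derivative
    have hc : ContinuousOn (fun z => (T.symm.arrowCongr (D.symm.trans T.symm)) (fderiv ℝ (slicePsiSu L) (T z))) (T ⁻¹' (U ∩ S ∩ O)) :=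
      (T.symm.arrowCongr (D.symm.trans T.symm)).continuous.comp_continuousOn
        (hUc.comp T.continuous.continuousOn fun z hz => hz.1.1)
    exact (hc.mono Set.inter_subset_left).congr fun z _ => fderiv_modelPsi D T z
  · -- the half-window condition
    rintro _ ⟨z, hz, rfl⟩
    exact hz.2
  · -- the link identity
    intro z hz x μ
    have hexp := hOexp (T z) hz.1.2 μ x
    rw [modelFrame_modelPsi D T hL, coe_adFrame_apply]
    have hLL : L (x, μ) * (L (x, μ))ᴴ = 1 := by
      have h := Matrix.mem_unitaryGroup_iff.1 (hL (x, μ)); simpa only [Matrix.star_eq_conjTranspose] using h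
    dsimp only
    rw [mul_exp_conj_of_unitary hLL]
    exact hexp

end Model

end Summit.QuantumFields.YangMills.Cruxes.IRcof.TwistedSlab

end
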